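import Literature.AlgebraicGeometry.Resolution.AlterationsSemiStableCodimTwoBlowupCentre
import Literature.AlgebraicGeometry.Resolution.BaseChangeOverOpens
import Mathlib.AlgebraicGeometry.Fiber
import HarnessLib

/-!
# De Jong's alteration theorem: the fibres of the blown-up curve, (ii) of the Claim of 3.4 reduced to the exceptional locus (de Jong 1996, 3.4)

Topic: `Literature/AlgebraicGeometry/Resolution`. Companion to
`AlterationsSemiStableCodimTwoBlowupCentre.lean`, which left de Jong 1996, Lemma 3.2
(`DeJong1996Lemma32.of_thickness_of_centre`) resting on the invariant `n_T`
(`DeJong1996SemiStableThickness`, itself reduced to 3.3 at `η_T`,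
`DeJong1996NodeLocalStructureCodimTwo`) and on ONE named fact for the Claim of 3.4 for one
blow-up `π : X' → X` of `T = cl{x}`, `DeJong1996SemiStableCodimTwoBlowupCentre`:
(ii) `π ≫ f` is a semi-stable curve, and (iii-E) the codimension-2 singular points of `X'`
inside the exceptional locus `E = π⁻¹(T)` (over `x`, at most one, thickness `n - 2`). That file
and `AlterationsSemiStableNodeStructure.lean` proved everything in (iii) that happens OFF `E`,
where `π` is a local isomorphism (Stacks 02OS). This file does the same for (ii) — the printed
proof reads (ii) off the charts of the formal-local model over the points of `T` only:

> "We remark that completion and blowing up commute in a suitable manner, so that it suffices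
> to compute the blow up of `Spec B'` (3.3) in the ideal `(u, v, t₁)`. … This blow up is covered
> by three affine charts …; we just give the affine algebras and the reader may read off
> properties (i)–(iv) from this. Chart "`u ≠ 0`". — … For the convenience of the reader we give
> the special fibre intersected with this chart; it is the spectrum of the ring
> `k[u, v, v', t₁']/(v - uv', ut₁', v') ≅ k[u, t₁']/(ut₁')` … This scheme is smooth over `k`,
> except at the maximal ideal `(u, t₁')`. …" (p. 64)

— so of 2.21 for `π ≫ f` ("a flat proper `f` of finite presentation, such that all geometric
fibres are connected curves having at most ordinary double points as singularities") only
flatness AT THE POINTS OVER `T`, the local structure of the geometric fibres AT THEIR CLOSED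
POINTS OVER `T`, and the connectedness of the EXCEPTIONAL FIBRES `π⁻¹(y)`, `y ∈ T` (the conics
glued from the special fibres of the three charts) depend on the charts. Accordingly this file

* vendors three NAMED FACTS, the chart-local content of the leaf:
  `DeJong1996SemiStableCodimTwoBlowupFlatNodal` ((ii) over `E`: flatness of `π ≫ f` at the
  points over `cl{x}`, and the closed points over `cl{x}` of the geometric fibres of `π ≫ f`
  are nonsingular points of curves or ordinary double points),
  `DeJong1996SemiStableCodimTwoBlowupExceptionalConnected` (the fibres of `π` over the points
  of `cl{x}` are geometrically connected), and `DeJong1996SemiStableCodimTwoBlowupNewComponent`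
  ((iii-E) verbatim: the two exceptional-locus clauses of `…Centre`);
* PROVES `flat_stalkMap_comp_of_isIso_stalkMap` (flatness of `π ≫ f` where `π` is a local
  isomorphism) and records `isIso_morphismRestrict_pullback_snd` — "isomorphism over the open
  `U`" is stable under base change, the case `P = isomorphisms` of
  `morphismRestrict_pullback_snd_of_morphismRestrict` (`BaseChangeOverOpens.lean`) — whence the
  fibre conditions of 2.21 transport between the geometric fibres `X_s̄` and `X'_s̄` off `E`
  (the base change `X'_s̄ → X_s̄` of the proper `π` is closed, so closed points go to closed
  points, and it is a local isomorphism off `E`);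
* PROVES `connectedSpace_of_isClosedMap_of_isConnected_fiber` — **Stacks 0377**: a closed
  continuous surjection with connected fibres onto a connected space has connected source —
  and `connectedSpace_pullback_comp`: the geometric fibre `X'_s̄ ≅ X' ×_X X_s̄` is connected,
  `X'_s̄ → X_s̄` being a closed surjection (base change of the proper surjective `π`) onto the
  connected `X_s̄` whose fibres are single points over `X ∖ T` and base changes of the
  exceptional fibres over `T`;
* PROVES the assembly `DeJong1996.SemiStablePair.isSemiStableCurve_comp_blowup` — **(ii) from
  its exceptional-locus content** (proper: blow-ups of Noetherian schemes are proper, Stacks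
  02NS; finite presentation: finite type over the Noetherian `Y`; flat, connected and nodal
  geometric fibres as above) — and `DeJong1996SemiStableCodimTwoBlowupCentre.of_fibres`, with
  the converse projections `…FlatNodal.of_centre`, `…NewComponent.of_centre`, and the
  assemblies down to `DeJong1996SemiStableCodimTwoModification`, `DeJong1996Lemma32`,
  `DeJong1996SemiStableCodimThree`: Lemma 3.2 now rests on `DeJong1996SemiStableThickness` (or
  `DeJong1996NodeLocalStructureCodimTwo`) and the three chart-local facts of this file.

The three named facts are nodes to decompose further through one common next layer: 2.23/3.3
at every point `y` of `T` (`B ≅ A'⟦u, v⟧/(Q - t₁^{n₁} ⋯ t_r^{n_r})`, the ideal of `T` being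
`(u, v, t₁)`), `IsBlowup.pullback_snd_of_flat` (`BlowupsFlatBaseChange.lean`) along
`Spec 𝒪̂_{X,y} → X`, the three charts of p. 64 and their gluing, and descent of flatness / the
fibre conditions / regularity / `Fitt₁` through completion.

## Sources

* A. J. de Jong, *Smoothness, semi-stability and alterations*, Publ. Math. IHÉS 83 (1996), 2.21
  (p. 61), 2.23 (pp. 61–62), 3.1–3.4 (pp. 62–64), 4.23 (p. 75).
* The Stacks Project, Tag 0377 (Lemma 5.7.5: connected fibres and connected base give a
  connected source, for a quotient map), Tag 02NS and Tag 02OS via `Blowups.lean`,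
  `BlowupsProperProofs.lean`.
* Q. Liu, *Algebraic Geometry and Arithmetic Curves* (2002), Prop. 10.3.15 (a), via
  `SemiStableCurvesBaseChange.lean` (transport of the node condition along ring isomorphisms).
-/

noncomputable section

open CategoryTheory CategoryTheory.Limits AlgebraicGeometry TopologicalSpace Topology IsLocalRing

namespace Literature.AlgebraicGeometry.Resolution

universe u

/-! ## Nothing changes where `π` is a local isomorphism -/

/-- **Flatness where `π` is a local isomorphism**: if `f` is flat and the stalk map of `π` at
`x'` is an isomorphism, then `π ≫ f` is flat at `x'` (a flat local homomorphism followed by an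
isomorphism). [folklore] -/
theorem flat_stalkMap_comp_of_isIso_stalkMap {X' X Y : Scheme.{u}} (π : X' ⟶ X)
    (f : X ⟶ Y) [Flat f] (x' : X') [IsIso (π.stalkMap x')] :
    ((π ≫ f).stalkMap x').hom.Flat := by
  have h : (f.stalkMap (π x') ≫ π.stalkMap x').hom.Flat := by
    rw [CommRingCat.hom_comp]
    exact RingHom.Flat.comp (Flat.stalkMap f (π x'))
      (RingHom.Flat.of_bijective (ConcreteCategory.bijective_of_isIso (π.stalkMap x')))
  rwa [← Scheme.Hom.stalkMap_comp] at h

/-! ## "Isomorphism over an open" under base change; fibres over such an open -/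

/-- **"Isomorphism over `U`" is stable under base change**: if `π : X' → X` restricts to an
isomorphism over the open `U ⊆ X`, then for every `p : P → X` the base change
`X' ×_X P → P` restricts to an isomorphism over `p⁻¹(U)` — the case `P = isomorphisms` of
`morphismRestrict_pullback_snd_of_morphismRestrict` (`BaseChangeOverOpens.lean`: the
restriction of the base change over `p⁻¹(U)` is a base change of `π|_U`), recorded under a
name for the instance mechanism. [folklore] -/
theorem isIso_morphismRestrict_pullback_snd {X' X P : Scheme.{u}} (π : X' ⟶ X) (p : P ⟶ X)
    (U : X.Opens) [h : IsIso (π ∣_ U)] :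
    IsIso ((pullback.snd π p) ∣_ (p ⁻¹ᵁ U)) :=
  morphismRestrict_pullback_snd_of_morphismRestrict (P := MorphismProperty.isomorphisms Scheme.{u})
    π p U h

/-- Where a morphism restricts to an isomorphism over an open `V`, its fibres over the points
of `V` are single points. [folklore] -/
theorem exists_preimage_singleton_eq_singleton_of_isIso_morphismRestrict {P' P : Scheme.{u}}
    (q : P' ⟶ P) (V : P.Opens) [IsIso (q ∣_ V)] {y : P} (hy : y ∈ V) :
    ∃ z : P', q ⁻¹' {y} = {z} := by
  let h := Scheme.homeoOfIso (asIso (q ∣_ V))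
  let z₀ := h.symm ⟨y, hy⟩
  have hz₀ : q z₀.1 = y := by
    rw [← morphismRestrict_base_coe]
    change (h (h.symm ⟨y, hy⟩)).1 = y
    rw [h.apply_symm_apply]
  refine ⟨z₀.1, Set.eq_singleton_iff_unique_mem.mpr ⟨hz₀, fun z hz => ?_⟩⟩
  have hzV : z ∈ q ⁻¹ᵁ V := by
    change q z ∈ V
    rw [show q z = y from hz]
    exact hy
  have : (⟨z, hzV⟩ : ↥(q ⁻¹ᵁ V)) = z₀ := by
    apply h.injective
    rw [h.apply_symm_apply]
    apply Subtype.ext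
    change ((q ∣_ V) ⟨z, hzV⟩).1 = y
    rw [morphismRestrict_base_coe]
    exact hz
  exact congrArg Subtype.val this

/-! ## Connected total space from connected fibres (Stacks 0377) -/

/-- **A space mapping onto a connected space by a closed continuous surjection with connected
fibres is connected** (Stacks, Tag 0377; from Mathlib's
`Topology.IsCoinducing.isConnected_preimage_of_isClosed`, a closed continuous surjection being
a quotient map). [cite: StacksProject, Tag 0377] -/
theorem connectedSpace_of_isClosedMap_of_isConnected_fiber {α β : Type*} [TopologicalSpace α]
    [TopologicalSpace β] [ConnectedSpace β] {f : α → β} (hf : Continuous f) (hcl : IsClosedMap f)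
    (hsurj : Function.Surjective f) (hfib : ∀ b, _root_.IsConnected (f ⁻¹' {b})) :
    ConnectedSpace α := by
  have hq := (hcl.isQuotientMap hf hsurj).isCoinducing
  have h := hq.isConnected_preimage_of_isClosed hfib isClosed_univ isConnected_univ
  rw [Set.preimage_univ] at h
  exact connectedSpace_iff_univ.mpr h

/-- The fibre of a morphism over a point is connected as a set as soon as the fibre SCHEME is
connected (Mathlib's `Scheme.Hom.fiberHomeo`). [folklore] -/
theorem isConnected_preimage_singleton_of_connectedSpace_fiber {P' P : Scheme.{u}} (q : P' ⟶ P)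
    (y : P) [ConnectedSpace ↥(q.fiber y)] : _root_.IsConnected (q ⁻¹' {y}) := by
  haveI : ConnectedSpace ↥(q ⁻¹' {y}) :=
    (q.fiberHomeo y).surjective.connectedSpace (q.fiberHomeo y).continuous
  exact isConnected_iff_connectedSpace.mpr inferInstance

/-- Connectedness of a fibre product `X' ×_X S` may be checked after a surjective base change
`S' → S` (the projection `X' ×_X S' → X' ×_X S` is surjective): in particular "geometrically
connected" fibres are connected over every field. [folklore] -/
theorem connectedSpace_pullback_of_surjective_comp {X' X S S' : Scheme.{u}} (π : X' ⟶ X)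
    (c : S ⟶ X) (ι : S' ⟶ S) [Surjective ι] [ConnectedSpace ↥(pullback π (ι ≫ c))] :
    ConnectedSpace ↥(pullback π c) := by
  let e : pullback (pullback.snd π c) ι ≅ pullback π (ι ≫ c) := pullbackLeftPullbackSndIso π c ι
  haveI : ConnectedSpace ↥(pullback (pullback.snd π c) ι) :=
    (Scheme.homeoOfIso e.symm).surjective.connectedSpace (Scheme.homeoOfIso e.symm).continuous
  exact (pullback.fst (pullback.snd π c) ι).surjective.connectedSpace
    (pullback.fst (pullback.snd π c) ι).continuous

/-- **Connected geometric fibres from connected exceptional fibres.** Let `π : X' → X` be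
universally closed and surjective, `f : X → Y`, `s : S → Y` with `X ×_Y S` connected. If `π`
restricts to an isomorphism over an open `U ⊆ X` and the fibres of `π` over the points of
`X ×_Y S` outside `U` are connected after base change to their residue fields, then `X' ×_Y S`
is connected: `X' ×_Y S ≅ X' ×_X (X ×_Y S) → X ×_Y S` is a closed continuous surjection onto a
connected space whose fibres are points over `U` (`isIso_morphismRestrict_pullback_snd`) and the
said base changes elsewhere (Stacks 0377). [cite: StacksProject, Tag 0377] -/
theorem connectedSpace_pullback_comp {X' X Y S : Scheme.{u}} (π : X' ⟶ X) (f : X ⟶ Y)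
    (s : S ⟶ Y) [UniversallyClosed π] [Surjective π] [ConnectedSpace ↥(pullback f s)]
    (U : X.Opens) [IsIso (π ∣_ U)]
    (hfib : ∀ y : ↥(pullback f s), pullback.fst f s y ∉ U →
      ConnectedSpace ↥(pullback π ((pullback f s).fromSpecResidueField y ≫ pullback.fst f s))) :
    ConnectedSpace ↥(pullback (π ≫ f) s) := by
  set p₁ := pullback.fst f s
  set q := pullback.snd π p₁
  haveI : IsIso (q ∣_ (p₁ ⁻¹ᵁ U)) := isIso_morphismRestrict_pullback_snd π p₁ U
  haveI : ConnectedSpace ↥(pullback π p₁) := by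
    refine connectedSpace_of_isClosedMap_of_isConnected_fiber q.continuous q.isClosedMap
      q.surjective fun y => ?_
    by_cases hy : p₁ y ∈ U
    · obtain ⟨z, hz⟩ :=
        exists_preimage_singleton_eq_singleton_of_isIso_morphismRestrict q (p₁ ⁻¹ᵁ U) hy
      rw [hz]
      exact isConnected_singleton
    · haveI := hfib y hy
      let e : q.fiber y ≅ pullback π ((pullback f s).fromSpecResidueField y ≫ p₁) :=
        pullbackLeftPullbackSndIso π p₁ ((pullback f s).fromSpecResidueField y)
      haveI : ConnectedSpace ↥(q.fiber y) :=
        (Scheme.homeoOfIso e.symm).surjective.connectedSpace (Scheme.homeoOfIso e.symm).continuous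
      exact isConnected_preimage_singleton_of_connectedSpace_fiber q y
  let e := pullbackRightPullbackFstIso f s π
  exact (Scheme.homeoOfIso e).surjective.connectedSpace (Scheme.homeoOfIso e).continuous

/-! ## What is read off the charts: three named facts over the exceptional locus -/

open Scheme.IdealSheafData in
/-- NAMED FACT — **de Jong 1996, 3.4, Claim (ii) over the exceptional locus: flatness, and the
geometric fibres of the blown-up curve at their points over `T`.** Setting 3.1 (`S` excellent
regular, `D ⊂ S` a strict normal crossings divisor, `f : X → S` semi-stable, smooth over
`S ∖ D`), `T` an irreducible component of `Sing(X)` of codimension `2`, `φ : X' → X` the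
blowing up of `X` in the ideal sheaf of `T`: "(ii) `X'` is a semi-stable curve over `S`", read
off the three charts of the blow-up of `Spec B'`, `B' = A'[u, v]/(Q - t₁^{n₁} ⋯ t_r^{n_r})`
(3.3), in `(u, v, t₁)` (p. 64) — chart "`u ≠ 0`":
`A[u, v, v', t₁']/(v - uv', t₁ - ut₁', v' - t₁'^{n₁} u^{n₁-2} t₂^{n₂} ⋯ t_r^{n_r})`, whose special
fibre "is the spectrum of the ring `k[u, v, v', t₁']/(v - uv', ut₁', v') ≅ k[u, t₁']/(ut₁')` …
This scheme is smooth over `k`, except at the maximal ideal `(u, t₁')`"; chart "`v ≠ 0`" by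
symmetry; chart "`t₁ ≠ 0`": `A[u, v, u', v']/(u - t₁u', v - t₁v', u'v' - t₁^{n₁-2} t₂^{n₂} ⋯ t_r^{n_r})`.
Rendered for the curve `f : X → Y` of a pair in Situation 4.23 over an algebraically closed
field (`S = Y`), the generic point `x` of `T` (a non-regular point with `dim 𝒪_{X,x} ≤ 2`) and
any blowing up `π : X' → X` of `X` in the ideal sheaf of the reduced closed subscheme
`T = cl{x}`, as the content of (ii) that is LOCAL ON `X'` AT THE POINTS OVER THE CENTRE (at
the other points `π` is a local isomorphism and (ii) is inherited from `f`,
`DeJong1996.SemiStablePair.isSemiStableCurve_comp_blowup`): (a) at every point `x'` of `X'`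
with `π x' ∈ cl{x}` the local homomorphism `𝒪_{Y, f(π x')} → 𝒪_{X', x'}` is flat; (b) for
every geometric point `s̄ : Spec K → Y` (`K` algebraically closed) and every closed point
`x̄'` of the geometric fibre `X' ×_Y Spec K` whose image in `X` lies in `cl{x}`, the local ring
`𝒪_{X'_s̄, x̄'}` is regular of dimension `1`, or `x̄'` is an ordinary double point (2.21, 2.23:
`𝒪̂ ≅ K⟦u, v⟧/(uv)`). Users take `(h : DeJong1996SemiStableCodimTwoBlowupFlatNodal)`; it is a
node to decompose further (2.23/3.3 at the points of `T`, `IsBlowup.pullback_snd_of_flat`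
along `Spec 𝒪̂_{X,y} → X`, the three charts, descent of flatness and of the fibre conditions
through completion). [cite: DeJong1996, 3.4 Claim (ii), pp. 63–64] -/
def DeJong1996SemiStableCodimTwoBlowupFlatNodal : Prop :=
  ∀ (k : Type u) [Field k] [IsAlgClosed k] (X Y : Scheme.{u}) (f : X ⟶ Y)
    (g : Y ⟶ Spec (.of k)) (D : Set Y) (n : ℕ) (τ : Fin n → (Y ⟶ X)),
    DeJong1996.SemiStablePair f g D τ →
      ∀ x ∈ Scheme.singularLocusCodimLE X 2,
        ∀ (X' : Scheme.{u}) (π : X' ⟶ X),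
          IsBlowup π (vanishingIdeal ⟨closure {x}, isClosed_closure⟩) →
            (∀ x' : X', π x' ∈ closure ({x} : Set X) → ((π ≫ f).stalkMap x').hom.Flat) ∧
            (∀ (K : Type u) [Field K] [IsAlgClosed K] (s : Spec (.of K) ⟶ Y)
                (x' : ↥(pullback (π ≫ f) s)), IsClosed ({x'} : Set ↥(pullback (π ≫ f) s)) →
                π (pullback.fst (π ≫ f) s x') ∈ closure ({x} : Set X) →
                  (IsRegularLocalRing ((pullback (π ≫ f) s).presheaf.stalk x') ∧
                      ringKrullDim ((pullback (π ≫ f) s).presheaf.stalk x') = 1) ∨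
                    IsOrdinaryDoublePoint K x')

open Scheme.IdealSheafData in
/-- NAMED FACT — **de Jong 1996, 3.4, Claim (ii): the exceptional fibres are geometrically
connected.** Setting 3.1, `T ⊂ Sing(X)` an irreducible component of codimension `2`,
`φ : X' → X` the blowing up of `X` in the ideal sheaf of `T`: the part of "(ii) `X'` is a
semi-stable curve over `S`" — 2.21: "all geometric fibres are connected curves" — that is
global on a fibre of `φ`, read off the three charts of p. 64: over a point `y` of `T` the fibre
of `φ` is glued from the special fibres of the charts "`u ≠ 0`" (a line with coordinate `t₁'`:
`k[u, v, v', t₁']/(v - uv', ut₁', v')` at `u = 0`), "`v ≠ 0`" (symmetric) and "`t₁ ≠ 0`"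
(`u'v' = c`, `c` the value of `t₁^{n₁-2} t₂^{n₂} ⋯ t_r^{n_r}` at `y`) — the plane conic
`{UV = c W²}`: two lines meeting in one point, or a smooth conic — and is geometrically
connected. Rendered for the curve `f : X → Y` of a pair in Situation 4.23 over an
algebraically closed field, the generic point `x` of `T` and any blowing up `π : X' → X` in the
ideal sheaf of `T = cl{x}`: for every algebraically closed field `K` and every geometric
point `c : Spec K → X` with image in `cl{x}`, the geometric fibre `X' ×_X Spec K` of `π` is
connected (hence `X' ×_X Spec K` is connected for every field `K`,
`connectedSpace_pullback_of_surjective_comp`; with (i) and Stacks 0377 this yields the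
connectedness of the geometric fibres of `π ≫ f`, `connectedSpace_pullback_comp`). Users take
`(h : DeJong1996SemiStableCodimTwoBlowupExceptionalConnected)`; a node to decompose further
(2.23/3.3 at `y`, `IsBlowup.pullback_snd_of_flat`, the three charts and their gluing into the
conic). [cite: DeJong1996, 3.4 Claim (ii), pp. 63–64] -/
def DeJong1996SemiStableCodimTwoBlowupExceptionalConnected : Prop :=
  ∀ (k : Type u) [Field k] [IsAlgClosed k] (X Y : Scheme.{u}) (f : X ⟶ Y)
    (g : Y ⟶ Spec (.of k)) (D : Set Y) (n : ℕ) (τ : Fin n → (Y ⟶ X)),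
    DeJong1996.SemiStablePair f g D τ →
      ∀ x ∈ Scheme.singularLocusCodimLE X 2,
        ∀ (X' : Scheme.{u}) (π : X' ⟶ X),
          IsBlowup π (vanishingIdeal ⟨closure {x}, isClosed_closure⟩) →
            ∀ (K : Type u) [Field K] [IsAlgClosed K] (c : Spec (.of K) ⟶ X),
              Set.range c ⊆ closure ({x} : Set X) → ConnectedSpace ↥(pullback π c)

open Scheme.IdealSheafData in
/-- NAMED FACT — **de Jong 1996, 3.4, Claim (iii) on the exceptional locus: the new component
and the drop `n_T̃ = n_T - 2`** — the two exceptional-locus clauses of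
`DeJong1996SemiStableCodimTwoBlowupCentre`, verbatim, separated from (ii). Setting 3.1,
`T ⊂ Sing(X)` an irreducible component of codimension `2`, `φ : X' → X` the blowing up of `X`
in the ideal sheaf of `T`: "(iii) … There exists at most one such irreducible component
`T̃ ⊂ Sing(X')` lying above `T'`; … `T' = T` in which case we have `n_T̃ = n_T - 2`. … Chart
"`t₁ ≠ 0`". — Here we get `A[u, v, u', v']/(u - t₁u', v - t₁v', u'v' - t₁^{n₁-2} t₂^{n₂} ⋯ t_r^{n_r})`.
Again the situation is rather clear. The "new" component `T̃` lying over `T` is given by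
`u' = v' = t₁ = 0`, unless `n₁ = 2, 3`, then `T̃` lying over `T` does not exist. Clearly, `n_T`
has dropped by 2." Rendered for the curve `f : X → Y` of a pair in Situation 4.23 over an
algebraically closed field, the generic point `x` of `T` and any blowing up `π : X' → X` in
the ideal sheaf of `T = cl{x}`: every codimension-`≤ 2` singular point `x̃` of `X'`
(`Scheme.singularLocusCodimLE X' 2`) with `π x̃ ∈ cl{x}` lies over `x` itself and has
thickness `n(x̃) + 2 = n(x)` (`Scheme.Hom.nodeThickness`), and there is at most one such `x̃`.
Users take `(h : DeJong1996SemiStableCodimTwoBlowupNewComponent)`; a node to decompose further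
(3.3 at `x`, `DeJong1996NodeLocalStructureCodimTwo`; `IsBlowup.pullback_snd_of_flat` along
`Spec 𝒪̂_{X,x} → X`; the regular locus and `Fitt₁` of chart "`t₁ ≠ 0`" through completion).
[cite: DeJong1996, 3.4 Claim (iii), pp. 63–64] -/
def DeJong1996SemiStableCodimTwoBlowupNewComponent : Prop :=
  ∀ (k : Type u) [Field k] [IsAlgClosed k] (X Y : Scheme.{u}) (f : X ⟶ Y)
    (g : Y ⟶ Spec (.of k)) (D : Set Y) (n : ℕ) (τ : Fin n → (Y ⟶ X)),
    DeJong1996.SemiStablePair f g D τ →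
      ∀ x ∈ Scheme.singularLocusCodimLE X 2,
        ∀ (X' : Scheme.{u}) (π : X' ⟶ X),
          IsBlowup π (vanishingIdeal ⟨closure {x}, isClosed_closure⟩) →
            (∀ x' ∈ Scheme.singularLocusCodimLE X' 2, π x' ∈ closure ({x} : Set X) →
              π x' = x ∧
                Scheme.Hom.nodeThickness (π ≫ f) x' + 2 = Scheme.Hom.nodeThickness f x) ∧
            (∀ x' ∈ Scheme.singularLocusCodimLE X' 2, ∀ x'' ∈ Scheme.singularLocusCodimLE X' 2,
              π x' ∈ closure ({x} : Set X) → π x'' ∈ closure ({x} : Set X) → x' = x'')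

/-! ## (ii) from its exceptional-locus content -/

namespace DeJong1996

namespace SemiStablePair

variable {k : Type u} [Field k] {X Y : Scheme.{u}} {f : X ⟶ Y} {g : Y ⟶ Spec (.of k)}
  {D : Set Y} {n : ℕ} {τ : Fin n → (Y ⟶ X)}

open Scheme.IdealSheafData in
/-- **de Jong 1996, 3.4, Claim (ii) for one blow-up from its exceptional-locus content.** Let
`π : X' → X` be a blowing up of the curve `f : X → Y` of a pair in Situation 4.23 in the ideal
sheaf of `cl{x}`, `x` a non-regular point. Suppose that, at the points of `X'` over `cl{x}`,
`π ≫ f` is flat and the closed points of its geometric fibres are nonsingular points of curves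
or ordinary double points, and that the fibres of `π` over the points of `cl{x}` are
geometrically connected. Then `π ≫ f` is a semi-stable curve (2.21): it is proper (blow-ups of
Noetherian schemes are proper, Stacks 02NS) and of finite presentation (finite type over the
Noetherian `Y`); by (i) `π` is an isomorphism over `U = X ∖ cl{x}` (Stacks 02OS), hence a
local isomorphism at every point not over the centre, so `π ≫ f` is flat there; "isomorphism
over `U`" being stable under the base change to a geometric fibre `X_s̄`, and `X'_s̄ → X_s̄`
being closed, the local rings of `X'_s̄` and `X_s̄` at corresponding closed points off the
exceptional locus are isomorphic, whence the fibre conditions there (transport of regularity,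
dimension and the node condition along ring isomorphisms); and `X'_s̄` is connected by Stacks
0377. [cite: DeJong1996, 3.4 Claim (ii), pp. 63–64] -/
theorem isSemiStableCurve_comp_blowup [IsAlgClosed k] (hS : SemiStablePair f g D τ) {x : X}
    (hx : ¬ IsRegularLocalRing (X.presheaf.stalk x)) {X' : Scheme.{u}} {π : X' ⟶ X}
    (hπ : IsBlowup π (vanishingIdeal ⟨closure {x}, isClosed_closure⟩))
    (hflat : ∀ x' : X', π x' ∈ closure ({x} : Set X) → ((π ≫ f).stalkMap x').hom.Flat)
    (hnodal : ∀ (K : Type u) [Field K] [IsAlgClosed K] (s : Spec (.of K) ⟶ Y)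
      (x' : ↥(pullback (π ≫ f) s)), IsClosed ({x'} : Set ↥(pullback (π ≫ f) s)) →
      π (pullback.fst (π ≫ f) s x') ∈ closure ({x} : Set X) →
        (IsRegularLocalRing ((pullback (π ≫ f) s).presheaf.stalk x') ∧
            ringKrullDim ((pullback (π ≫ f) s).presheaf.stalk x') = 1) ∨
          IsOrdinaryDoublePoint K x')
    (hconn : ∀ (K : Type u) [Field K] [IsAlgClosed K] (c : Spec (.of K) ⟶ X),
      Set.range c ⊆ closure ({x} : Set X) → ConnectedSpace ↥(pullback π c)) :
    IsSemiStableCurve (π ≫ f) := by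
  haveI := hS.isIntegral
  haveI := hS.isNoetherian
  haveI := hS.isNoetherian_base
  haveI : Flat f := hS.isSemiStableCurve.flat
  haveI : IsProper f := hS.isSemiStableCurve.isProper
  have hπm : IsModification π := IsModification.of_isBlowup hπ (hS.vanishingIdeal_closure_ne_bot hx)
  haveI : IsProper π := hπm.isProper
  haveI : IsDominant π := hπm.isDominant
  -- (i): `π` is an isomorphism over `U = X ∖ cl{x}`
  let U : X.Opens := ⟨(closure ({x} : Set X))ᶜ, isClosed_closure.isOpen_compl⟩
  haveI hisoU : IsIso (π ∣_ U) :=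
    hπ.isIso_morphismRestrict_of_notMem fun h => h (subset_closure (Set.mem_singleton x))
  have hmemU : ∀ {x' : X'}, π x' ∉ closure ({x} : Set X) → π x' ∈ U := fun h => h
  refine ⟨?_, inferInstance, inferInstance, fun K _ _ s => ?_, fun K _ _ s xb hxb => ?_⟩
  · -- flat
    refine Flat.of_stalkMap _ fun x' => ?_
    by_cases h : π x' ∈ closure ({x} : Set X)
    · exact hflat x' h
    · haveI := hπ.isIso_stalkMap_of_notMem_closure h
      exact flat_stalkMap_comp_of_isIso_stalkMap π f x'
  · -- connected geometric fibres (Stacks 0377)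
    haveI := hS.isSemiStableCurve.connectedSpace_pullback K s
    refine connectedSpace_pullback_comp π f s U fun y hy => ?_
    -- the fibre of `π` over `p₁ y ∈ cl{x}` is geometrically connected, hence connected over `κ(y)`
    let κ := (pullback f s).residueField y
    let ι : Spec (.of (AlgebraicClosure κ)) ⟶ Spec κ :=
      Spec.map (CommRingCat.ofHom (algebraMap κ (AlgebraicClosure κ)))
    haveI : Surjective ι := DeJong1996.Stage.surjective_specMap (algebraMap κ (AlgebraicClosure κ))
    haveI := hconn (AlgebraicClosure κ)
      (ι ≫ (pullback f s).fromSpecResidueField y ≫ pullback.fst f s) (by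
        rintro _ ⟨t, rfl⟩
        have ht : (pullback f s).fromSpecResidueField y (ι t) ∈ ({y} : Set ↥(pullback f s)) :=
          (Scheme.range_fromSpecResidueField y).le ⟨ι t, rfl⟩
        rw [Set.mem_singleton_iff] at ht
        rw [Scheme.Hom.comp_apply, Scheme.Hom.comp_apply, ht]
        exact not_not.mp hy)
    exact connectedSpace_pullback_of_surjective_comp π _ ι
  · -- the closed points of the geometric fibres
    by_cases h : π (pullback.fst (π ≫ f) s xb) ∈ closure ({x} : Set X)
    · exact hnodal K s xb hxb h
    · -- transport from the geometric fibre `X_s̄` of `f`, through `X'_s̄ ≅ X' ×_X X_s̄ → X_s̄`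
      let p₁ := pullback.fst f s
      let q := pullback.snd π p₁
      haveI : IsIso (q ∣_ (p₁ ⁻¹ᵁ U)) := isIso_morphismRestrict_pullback_snd π p₁ U
      let e := pullbackRightPullbackFstIso f s π
      let z := e.inv xb
      have hz : pullback.fst π p₁ z = pullback.fst (π ≫ f) s xb := by
        change (e.inv ≫ pullback.fst π p₁) xb = _
        rw [pullbackRightPullbackFstIso_inv_fst]
      have hqz : p₁ (q z) = π (pullback.fst π p₁ z) := by
        rw [← Scheme.Hom.comp_apply q p₁ z, ← Scheme.Hom.comp_apply (pullback.fst π p₁) π z,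
          pullback.condition]
      have hzU : q z ∈ p₁ ⁻¹ᵁ U := by
        change p₁ (q z) ∈ U
        rw [hqz, hz]
        exact hmemU h
      haveI := isIso_stalkMap_of_isIso_morphismRestrict q (p₁ ⁻¹ᵁ U) z hzU
      -- `q z` is a closed point of `X_s̄` (`q` is closed, `xb` is closed)
      have hzc : IsClosed ({z} : Set ↥(pullback π p₁)) := by
        have : ({z} : Set ↥(pullback π p₁)) = e.inv '' {xb} := by rw [Set.image_singleton]
        rw [this]
        exact e.inv.isClosedEmbedding.isClosedMap _ hxb
      have hqzc : IsClosed ({q z} : Set ↥(pullback f s)) := by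
        have : ({q z} : Set ↥(pullback f s)) = q '' {z} := by rw [Set.image_singleton]
        rw [this]
        exact q.isClosedMap _ hzc
      -- the local rings `𝒪_{X_s̄, q z} ≅ 𝒪_{X'_s̄, xb}`
      let ε : (pullback f s).presheaf.stalk (q z) ≃+* (pullback (π ≫ f) s).presheaf.stalk xb :=
        (asIso (q.stalkMap z)).commRingCatIsoToRingEquiv.trans
          (asIso (e.inv.stalkMap xb)).commRingCatIsoToRingEquiv
      rcases hS.isSemiStableCurve.isRegularLocalRing_or_isOrdinaryDoublePoint K s (q z) hqzc with
        ⟨hreg, hdim⟩ | hnode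
      · left
        haveI := hreg
        exact ⟨IsRegularLocalRing.of_ringEquiv ε, by rw [← ringKrullDim_eq_of_ringEquiv ε, hdim]⟩
      · exact Or.inr (hnode.of_ringEquiv ε)

end SemiStablePair

end DeJong1996

/-! ## The leaf `DeJong1996SemiStableCodimTwoBlowupCentre` from the three chart-local facts -/

/-- **`DeJong1996SemiStableCodimTwoBlowupCentre` (the Claim of 3.4 for one blow-up: (ii), and
(iii) on the exceptional locus) from the three chart-local facts** of this file: (ii) by
`DeJong1996.SemiStablePair.isSemiStableCurve_comp_blowup` from `…FlatNodal` and
`…ExceptionalConnected`; (iii-E) is `…NewComponent`. [cite: DeJong1996, 3.4, pp. 63–64] -/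
theorem DeJong1996SemiStableCodimTwoBlowupCentre.of_fibres
    (hA : DeJong1996SemiStableCodimTwoBlowupFlatNodal.{u})
    (hC : DeJong1996SemiStableCodimTwoBlowupExceptionalConnected.{u})
    (hN : DeJong1996SemiStableCodimTwoBlowupNewComponent.{u}) :
    DeJong1996SemiStableCodimTwoBlowupCentre.{u} := by
  intro k _ _ X Y f g D n τ hS x hx X' π hπ
  obtain ⟨hflat, hnodal⟩ := hA k X Y f g D n τ hS x hx X' π hπ
  obtain ⟨hover, huniq⟩ := hN k X Y f g D n τ hS x hx X' π hπ
  exact ⟨hS.isSemiStableCurve_comp_blowup hx.1 hπ hflat hnodal (hC k X Y f g D n τ hS x hx X' π hπ),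
    hover, huniq⟩

/-- Sanity of the cut: `…Centre` gives back `…FlatNodal` (a semi-stable curve is flat, and all
closed points of its geometric fibres satisfy the fibre conditions of 2.21). [folklore] -/
theorem DeJong1996SemiStableCodimTwoBlowupFlatNodal.of_centre
    (h : DeJong1996SemiStableCodimTwoBlowupCentre.{u}) :
    DeJong1996SemiStableCodimTwoBlowupFlatNodal.{u} := by
  intro k _ _ X Y f g D n τ hS x hx X' π hπ
  obtain ⟨hss, -, -⟩ := h k X Y f g D n τ hS x hx X' π hπ
  haveI := hss.flat
  exact ⟨fun x' _ => Flat.stalkMap (π ≫ f) x',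
    fun K _ _ s x' hx' _ => hss.isRegularLocalRing_or_isOrdinaryDoublePoint K s x' hx'⟩

/-- Sanity of the cut: `…Centre` gives back `…NewComponent` (its last two clauses). [folklore] -/
theorem DeJong1996SemiStableCodimTwoBlowupNewComponent.of_centre
    (h : DeJong1996SemiStableCodimTwoBlowupCentre.{u}) :
    DeJong1996SemiStableCodimTwoBlowupNewComponent.{u} := by
  intro k _ _ X Y f g D n τ hS x hx X' π hπ
  obtain ⟨-, hover, huniq⟩ := h k X Y f g D n τ hS x hx X' π hπ
  exact ⟨hover, huniq⟩

/-! ## The assemblies -/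

/-- `DeJong1996SemiStableCodimTwoBlowup` (the Claim of 3.4 for one blow-up, in full) from the
three chart-local facts. [cite: DeJong1996, 3.4, pp. 63–64] -/
theorem DeJong1996SemiStableCodimTwoBlowup.of_fibres
    (hA : DeJong1996SemiStableCodimTwoBlowupFlatNodal.{u})
    (hC : DeJong1996SemiStableCodimTwoBlowupExceptionalConnected.{u})
    (hN : DeJong1996SemiStableCodimTwoBlowupNewComponent.{u}) :
    DeJong1996SemiStableCodimTwoBlowup.{u} :=
  DeJong1996SemiStableCodimTwoBlowup.of_core
    (DeJong1996SemiStableCodimTwoBlowupCore.of_centre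
      (DeJong1996SemiStableCodimTwoBlowupCentre.of_fibres hA hC hN))

/-- **`DeJong1996SemiStableCodimTwoModification` from `DeJong1996SemiStableThickness` and the
three chart-local facts of 3.4.** [cite: DeJong1996, 3.3–3.4, pp. 63–64] -/
theorem DeJong1996SemiStableCodimTwoModification.of_thickness_of_fibres
    (h2 : DeJong1996SemiStableThickness.{u})
    (hA : DeJong1996SemiStableCodimTwoBlowupFlatNodal.{u})
    (hC : DeJong1996SemiStableCodimTwoBlowupExceptionalConnected.{u})
    (hN : DeJong1996SemiStableCodimTwoBlowupNewComponent.{u}) :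
    DeJong1996SemiStableCodimTwoModification.{u} :=
  DeJong1996SemiStableCodimTwoModification.of_thickness_of_centre h2
    (DeJong1996SemiStableCodimTwoBlowupCentre.of_fibres hA hC hN)

/-- `DeJong1996SemiStableCodimTwoModification` from 3.3 at `η_T`
(`DeJong1996NodeLocalStructureCodimTwo`) and the three chart-local facts of 3.4 — the four
current leaves below de Jong's Lemma 3.2. [cite: DeJong1996, 3.3–3.4, pp. 63–64] -/
theorem DeJong1996SemiStableCodimTwoModification.of_nodeLocalStructure_of_fibres
    (hL : DeJong1996NodeLocalStructureCodimTwo.{u})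
    (hA : DeJong1996SemiStableCodimTwoBlowupFlatNodal.{u})
    (hC : DeJong1996SemiStableCodimTwoBlowupExceptionalConnected.{u})
    (hN : DeJong1996SemiStableCodimTwoBlowupNewComponent.{u}) :
    DeJong1996SemiStableCodimTwoModification.{u} :=
  DeJong1996SemiStableCodimTwoModification.of_nodeLocalStructure_of_centre hL
    (DeJong1996SemiStableCodimTwoBlowupCentre.of_fibres hA hC hN)

/-- **de Jong 1996, Lemma 3.2** from `DeJong1996SemiStableThickness` and the three chart-local
facts of 3.4. [cite: DeJong1996, 3.2–3.4, pp. 62–64] -/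
theorem DeJong1996Lemma32.of_thickness_of_fibres (h2 : DeJong1996SemiStableThickness.{u})
    (hA : DeJong1996SemiStableCodimTwoBlowupFlatNodal.{u})
    (hC : DeJong1996SemiStableCodimTwoBlowupExceptionalConnected.{u})
    (hN : DeJong1996SemiStableCodimTwoBlowupNewComponent.{u}) : DeJong1996Lemma32.{u} :=
  DeJong1996Lemma32.of_thickness_of_centre h2
    (DeJong1996SemiStableCodimTwoBlowupCentre.of_fibres hA hC hN)

/-- `DeJong1996SemiStableCodimThree` (4.24, first sentence) from `DeJong1996SemiStableThickness`
and the three chart-local facts of 3.4. [cite: DeJong1996, 3.2–3.4 and 4.24, pp. 62–64, 75] -/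
theorem DeJong1996SemiStableCodimThree.of_thickness_of_fibres
    (h2 : DeJong1996SemiStableThickness.{u})
    (hA : DeJong1996SemiStableCodimTwoBlowupFlatNodal.{u})
    (hC : DeJong1996SemiStableCodimTwoBlowupExceptionalConnected.{u})
    (hN : DeJong1996SemiStableCodimTwoBlowupNewComponent.{u}) :
    DeJong1996SemiStableCodimThree.{u} :=
  DeJong1996SemiStableCodimThree.of_thickness_of_centre h2
    (DeJong1996SemiStableCodimTwoBlowupCentre.of_fibres hA hC hN)

end Literature.AlgebraicGeometry.Resolution

end
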